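import Literature.Geometry.Kaehler.ComplexTorusTotalLieAlgebraRatDualLefschetz
import HarnessLib

/-!
# The image of `f` spans `𝔤_tot(X; ℚ)₋₂`: `𝔤_tot(X; ℚ)₋₂ = span_ℚ {f_η : η ∈ H²(X; ℚ) non-degenerate}` — the
# non-degenerate rational `2`-vectors span `⋀²V_ℚ` (Looijenga–Lunts 1997, §1 (1.1) (ii), §3 proof of (3.3))

Layer `Literature/Geometry/Kaehler`, namespace `Literature.Geometry.Kaehler.ComplexTorus` (§1–§3) after a generic matrix
section §0 (namespace `Literature.LinearAlgebra.Matrix`); lane `lit-hodgefound` (Track 2 foundations library, Layer A: Hodge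
theory of complex tori on invariant forms), skeleton seat `lit-hodgefound-skel-1` (generation 37), row **A1-82** of
`run/shared/lean/pub/lit-hodgefound/SKELETON.md`.  A sequel BY NAME (nothing restated) of rows A1-81
(`ComplexTorusTotalLieAlgebraRatDualLefschetz`: for a rational non-degenerate real `2`-form `η` with rational Gram matrix `G₀`,
`f_η = ½ ∑ (G₀⁻¹)_{lk} i_{λ_l}i_{λ_k} ∈ 𝔤_tot(X; ℚ)₋₂` — `lefschetzDualG_eq_sum`, `lefschetzDualG_mem_totalLieAlgebraRatDeg_negTwo`),
A1-74/A1-75 (`ComplexTorusTotalLieAlgebraRatTypeDGrading` / `…RatGrading`: `ρ(T_{ψ₋₂(B)}) = -½ ∑ B_{ik} i_{λ_i}i_{λ_k}`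
(`spinorRepLin_ratEndo_lowD`) and, for `g ≥ 2`, `𝔤_tot(X; ℚ)₋₂ = {ρ(T_{ψ₋₂(B)}) : B ∈ 𝔰𝔬_ι(ℚ)}`
(`mem_totalLieAlgebraRatDeg_negTwo_iff`)), A1-53 (`ComplexTorusNeronSeveriLieBracket`: `nondegenerate_of_map_ratCast` — a form
with invertible rational Gram matrix is non-degenerate) and A2 (`ComplexTorusPolarizationType`: `latticeGram`,
`dotProduct_latticeGram_mulVec`).
THEOREMS ONLY: no definition, no instance, no local instance attribute, no named fact, no `sorry` (D-0026 net debt `0`).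

## Sources, VERBATIM

E. Looijenga, V. A. Lunts, *A Lie algebra attached to a projective variety*, Invent. Math. **129** (1997) 361–412 (held
text `paper:arxiv-alg-geom_9604014`; page/line numbers of that text):

> (§1, Lefschetz triples, p0007 L55–L66) "(i) […] there is a rational map `f : 𝔞 → 𝔤₋₂` so that for `e` in the domain of
> `f`, we have an `𝔰𝔩(2)`-triple `(e, h, f_e)` and **(ii) `𝔤` is as a Lie algebra generated by `𝔞` and the image of `f`.**"
> (§3, proof of (3.3), p0013 L100–L107) "it follows that `f_κ` is defined and equal to `∑_{k=1}^n i_{a_{-k}} i_{a_k}`. **The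
> nondegenerate `2`-forms make up a nonempty open subset of `⋀²V^*` and therefore span that space. The corresponding
> `2`-vectors form an open subset of `⋀²V` and so `𝔤_tot(X)` is generated by `𝔤₂ ⊕ 𝔤₋₂` as a Lie algebra.**"
> (§1 (1.9), p0006 L119–L122) "we often write `𝔤_*(X; K)` for the corresponding Lie algebra of `K`-points."

The "open subset spans" argument is replaced, over the RATIONAL points, by an algebraic one (§0): for an invertible `B₀`
and any `C`, `t ↦ det(B₀ + tC)` is a non-zero polynomial, so `B₀ + tC` is invertible for some `t ≠ 0` in the infinite
field `ℚ`, and `C = t⁻¹((B₀ + tC) - B₀)` is a combination of two invertible matrices of the same symmetry type.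

## Dictionary

`X = E/Φ(ℤ^ι)` (`g = dim_ℂ E`, `|ι| = 2g`), lattice basis `λ_a = periodBasis Φ a = Φ(e_a)`, `dx_a = latticeDx Φ a`; `Hᵏ(X; ℚ) =
rationalForms Φ k`; `f_η = Λ_η = lefschetzDualG η`; Gram matrix `G = latticeGram Φ η`, `G_{ab} = η(λ_a, λ_b)`; `ρ(T_M) =
spinorRepLin E (ratEndo Φ M)` (row A1-72), `ψ₋₂(B) = lowD B`; `𝔤_tot(X; ℚ)₋₂ = totalLieAlgebraRatDeg Φ (-2)`; `𝔰𝔬_l(K) =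
LieAlgebra.Orthogonal.so l K` (skew-symmetric matrices, `⋀²`).  "`η` rational non-degenerate" = `ofRealForm η ∈ rationalForms Φ 2`
and `∀ v ≠ 0, ∃ w, η(v, w) ≠ 0` — the DOMAIN of `f` on the rational points.

## What is formalised (all `theorem`s, proved)

* §0 GENERIC (`Literature.LinearAlgebra.Matrix`; `K` a field, `l` finite): the `2 × 2` block `S = (0 1; -1 0)` (`Sᵀ = -S`,
  `S² = -1`), the block-diagonal symplectic matrix `J = diag(S, …, S)` on `Fin 2 × m` (`Jᵀ = -J`, `J² = -1`),
  **`exists_mem_so_isUnit_det` — an index type `l ≃ Fin 2 × m` carries an invertible skew matrix**, the private helpers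
  `eval_det_add_X_smul` (`det(B₀ + X·C)` evaluates to `det(B₀ + tC)`) and `exists_ne_zero_isUnit_det_add_smul` (`det(B₀ + tC) ≠ 0`
  for some `t ≠ 0` when `det B₀ ≠ 0`, `K` infinite), and **`mem_span_so_isUnit_det` / `mem_span_so_isUnit_det_of_equiv` — THE INVERTIBLE
  SKEW-SYMMETRIC MATRICES SPAN `𝔰𝔬_l(K)`** (`|l|` even, `K` infinite).
* §1 GRAM REALISATION (every complex torus): `pairForm_latticeDx_apply_single`,
  **`exists_map_ratCast_eq_latticeGram_of_transpose_eq_neg` — every skew rational matrix `G₀` is the Gram matrix of the real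
  `2`-form `η_G = ½ ∑ G_{ab} dx_a ∧ dx_b`**, `ofRealForm_mem_rationalForms_of_map_ratCast_eq_latticeGram` (rational Gram matrix ⇒
  rational class; converse of row A1-81's `exists_map_ratCast_eq_latticeGram`), `exists_rational_nondegenerate_latticeGram_eq`
  (invertible skew rational `G₀` ⇒ a rational NON-DEGENERATE `η`), `nonempty_equiv_fin_two_prod` (`ι ≃ Fin 2 × Fin g`),
  **`exists_rational_nondegenerate_twoForm` — the domain of `f` over `ℚ` is non-empty on every complex torus.**
* §2 **`lefschetzDualG_eq_spinorRepLin_ratEndo_lowD` — `f_η = ρ(T_{ψ₋₂(-G₀⁻¹)})`** (row A1-81's sum formula matched with row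
  A1-74's `spinorRepLin_ratEndo_lowD`) and **`exists_lefschetzDualG_eq_of_isUnit_det` — every `ρ(T_{ψ₋₂(B)})` with `B` invertible
  skew rational IS `f_η` for a rational non-degenerate `η`** (Gram matrix `-B⁻¹`).
* §3 `spinorRepLin_ratEndo_lowD_mem_span_lefschetzDualG` (every `ρ(T_{ψ₋₂(C)})`, `C` skew rational, is a `ℚ`-combination of
  `f_η`'s) and **`totalLieAlgebraRatDeg_negTwo_eq_span_lefschetzDualG` — `𝔤_tot(X; ℚ)₋₂ = span_ℚ {f_η : η rational non-degenerate}`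
  (`g ≥ 2`)**: with rows A1-79 (`𝔤_tot(X; ℚ)` is generated by `𝔤₂(ℚ) ∪ 𝔤₋₂(ℚ)`) and A1-80 (`𝔤₂(ℚ) = e(H²(X; ℚ))`) this is
  clause (ii) of the Lefschetz triple `(𝔤_tot(X; ℚ), h, H²(X; ℚ))` on the rational points — `𝔤_tot(X; ℚ)` is generated by
  `e(H²(X; ℚ))` and the image of `f`; VALIDATION `finrank_span_lefschetzDualG_finTwo` (abelian surface: the `f_η` span a
  `6`-dimensional space `= 𝔤_tot(X; ℚ)₋₂ ≅ ⋀²ℚ⁴`).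

## SCOPE (what is NOT claimed)

(a) `g ≥ 2` in the span EQUALITY of §3 (it uses row A1-75's description of `𝔤_tot(X; ℚ)₋₂`, stated for `g ≥ 2`); §0–§2 and
the inclusion "`f_η ∈ 𝔤₋₂(ℚ)`" hold for every torus.  (b) The three rows A1-79/A1-80/A1-82 are not assembled into a single
"Lefschetz triple" structure (no such structure is defined in the tree); "saturated" (maximality of `𝔞 = H²(X; ℚ)`) is NOT
proved.  (c) No Hodge-type or positivity hypothesis anywhere; nothing about `𝔤_NS`, `𝔤_K`, `𝔤_MT`.  (d) Nothing in this
file is a case of the Hodge conjecture.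

## References

* [LooijengaLunts1997] E. Looijenga, V. A. Lunts, *A Lie algebra attached to a projective variety*, Invent. Math. 129 (1997)
  361–412; arXiv:alg-geom/9604014. §1 (1.1), (1.9); §3 (3.1)–(3.3) and the proof of (3.3) (held `paper:arxiv-alg-geom_9604014`,
  p0006–p0007, p0012–p0013).
* [Lange2023AbelianVarietiesComplex] H. Lange, *Abelian Varieties over the Complex Numbers*, Springer (2023), §1.1.4
  Prop. 1.1.20, §1.5.1 (the alternating matrix of a form on a lattice basis).
* [FultonHarris1991] W. Fulton, J. Harris, *Representation Theory. A First Course*, GTM 129, Springer (1991), §18.1.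
* [McDuffSalamon2017] D. McDuff, D. Salamon, *Introduction to Symplectic Topology*, 3rd ed., Oxford (2017), §2.1
  Thm. 2.1.3 (standard symplectic bases; the matrix `J₀`).
-/

noncomputable section

-- `Module ℚ` / `Module ℂ` synthesis on `E [⋀^Fin k]→L[ℝ] ℂ`, as in the parent files
set_option maxSynthPendingDepth 3

open Module Function
open scoped Matrix

/-! ### §0 Generic: invertible skew-symmetric matrices span `𝔰𝔬_l(K)` (`|l|` even, `K` an infinite field) -/

namespace Literature.LinearAlgebra.Matrix

open LieAlgebra.Orthogonal (so mem_so)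

section InvertibleSkew

variable {K : Type*} [Field K]

/-- The standard `2 × 2` symplectic block `S = (0 1; -1 0)` (the matrix of `α_{-1} ∧ α_1`): `Sᵀ = -S`.
[cite: McDuffSalamon2017, §2.1 Thm. 2.1.3] [cite: LooijengaLunts1997, §3 proof of (3.3) ("κ = ∑ α_{-k} ∧ α_k")] -/
theorem transpose_stdSkewTwo : (!![0, 1; -1, 0] : Matrix (Fin 2) (Fin 2) K)ᵀ = -!![0, 1; -1, 0] := by
  ext i j
  fin_cases i <;> fin_cases j <;> simp

/-- `S² = -1` for `S = (0 1; -1 0)`. [cite: McDuffSalamon2017, §2.1 Thm. 2.1.3] -/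
theorem stdSkewTwo_mul_self : (!![0, 1; -1, 0] : Matrix (Fin 2) (Fin 2) K) * !![0, 1; -1, 0] = -1 := by
  ext i j
  fin_cases i <;> fin_cases j <;> simp [Matrix.mul_apply, Fin.sum_univ_two]

variable {m : Type*} [Fintype m] [DecidableEq m]

omit [Fintype m] in
/-- The block-diagonal symplectic matrix `J = diag(S, …, S)` on `Fin 2 × m` (the matrix of the standard symplectic form
`∑_k α_{-k} ∧ α_k`) is skew: `Jᵀ = -J`. [cite: McDuffSalamon2017, §2.1 Thm. 2.1.3] [cite: LooijengaLunts1997, §3 proof of (3.3)] -/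
theorem transpose_blockDiagonal_stdSkewTwo :
    (Matrix.blockDiagonal fun _ : m ↦ (!![0, 1; -1, 0] : Matrix (Fin 2) (Fin 2) K))ᵀ =
      -Matrix.blockDiagonal fun _ : m ↦ (!![0, 1; -1, 0] : Matrix (Fin 2) (Fin 2) K) := by
  rw [Matrix.blockDiagonal_transpose, ← Matrix.blockDiagonal_neg]
  congr 1
  funext k
  exact transpose_stdSkewTwo

/-- `J² = -1` for the block-diagonal symplectic matrix. [cite: McDuffSalamon2017, §2.1 Thm. 2.1.3] -/
theorem blockDiagonal_stdSkewTwo_mul_self :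
    (Matrix.blockDiagonal fun _ : m ↦ (!![0, 1; -1, 0] : Matrix (Fin 2) (Fin 2) K)) *
        Matrix.blockDiagonal (fun _ : m ↦ (!![0, 1; -1, 0] : Matrix (Fin 2) (Fin 2) K)) = -1 := by
  rw [← Matrix.blockDiagonal_mul, ← Matrix.blockDiagonal_one, ← Matrix.blockDiagonal_neg]
  congr 1
  funext k
  exact stdSkewTwo_mul_self

variable {l : Type*} [Fintype l] [DecidableEq l]

/-- **An index type of even cardinality carries an INVERTIBLE skew-symmetric matrix** (the standard symplectic matrix
`diag(S, …, S)` transported along `l ≃ Fin 2 × m`; `J² = -1`) — "the nondegenerate `2`-forms make up a nonempty open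
subset". [cite: LooijengaLunts1997, §3 proof of (3.3)] [cite: McDuffSalamon2017, §2.1 Thm. 2.1.3] -/
theorem exists_mem_so_isUnit_det (e : l ≃ Fin 2 × m) : ∃ J ∈ so l K, IsUnit J.det := by
  refine ⟨(Matrix.blockDiagonal fun _ : m ↦ (!![0, 1; -1, 0] : Matrix (Fin 2) (Fin 2) K)).submatrix e e, ?_, ?_⟩
  · rw [mem_so, Matrix.transpose_submatrix, transpose_blockDiagonal_stdSkewTwo]
    rfl
  · refine Matrix.isUnit_det_of_right_inverse
      (B := -(Matrix.blockDiagonal fun _ : m ↦ (!![0, 1; -1, 0] : Matrix (Fin 2) (Fin 2) K)).submatrix e e) ?_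
    rw [Matrix.mul_neg, Matrix.submatrix_mul_equiv, blockDiagonal_stdSkewTwo_mul_self]
    simp only [Matrix.submatrix_neg, Pi.neg_apply, Matrix.submatrix_one_equiv, neg_neg]

/-- `t ↦ det(B₀ + tC)` is a polynomial: the matrix `B₀ + X·C` over `K[X]` evaluates to `B₀ + tC`. [folklore] -/
private theorem eval_det_add_X_smul (B₀ C : Matrix l l K) (t : K) :
    (Matrix.det (B₀.map Polynomial.C + (Polynomial.X : Polynomial K) • C.map Polynomial.C)).eval t =
      (B₀ + t • C).det := by
  rw [← Polynomial.coe_evalRingHom, RingHom.map_det, RingHom.mapMatrix_apply]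
  congr 1
  ext i j
  simp
  exact mul_comm _ _

/-- **On a line through an invertible matrix almost every matrix is invertible**: if `det B₀ ≠ 0` then `det(B₀ + tC) ≠ 0`
for some `t ≠ 0` (indeed for all but finitely many `t`; `K` infinite). [folklore] -/
private theorem exists_ne_zero_isUnit_det_add_smul [Infinite K] {B₀ : Matrix l l K} (hB₀ : IsUnit B₀.det) (C : Matrix l l K) :
    ∃ t : K, t ≠ 0 ∧ IsUnit (B₀ + t • C).det := by
  classical
  set p : Polynomial K := Matrix.det (B₀.map Polynomial.C + (Polynomial.X : Polynomial K) • C.map Polynomial.C) with hp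
  have hp0 : p ≠ 0 := fun h ↦ by
    have h0 := eval_det_add_X_smul B₀ C 0
    rw [← hp, h, Polynomial.eval_zero, zero_smul, add_zero] at h0
    exact hB₀.ne_zero h0.symm
  obtain ⟨t, ht⟩ := Infinite.exists_notMem_finset (insert (0 : K) p.roots.toFinset)
  rw [Finset.mem_insert, not_or, Multiset.mem_toFinset, Polynomial.mem_roots hp0, Polynomial.IsRoot.def] at ht
  refine ⟨t, ht.1, isUnit_iff_ne_zero.2 ?_⟩
  rw [← eval_det_add_X_smul]
  exact ht.2

/-- **THE INVERTIBLE SKEW-SYMMETRIC MATRICES SPAN `𝔰𝔬_l(K)`** as soon as one exists (`|l|` even): every `C ∈ 𝔰𝔬_l(K)` is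
`t⁻¹((B₀ + tC) - B₀)` with both `B₀` and `B₀ + tC` invertible and skew (`K` an infinite field) — Looijenga–Lunts' "the
nondegenerate `2`-forms make up a nonempty open subset of `⋀²V^*` and therefore span that space", made algebraic over any
infinite field. [cite: LooijengaLunts1997, §3 proof of (3.3)] -/
theorem mem_span_so_isUnit_det [Infinite K] {B₀ : Matrix l l K} (hB₀ : B₀ ∈ so l K) (hB₀' : IsUnit B₀.det)
    {C : Matrix l l K} (hC : C ∈ so l K) : C ∈ Submodule.span K {B : Matrix l l K | B ∈ so l K ∧ IsUnit B.det} := by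
  obtain ⟨t, ht, hunit⟩ := exists_ne_zero_isUnit_det_add_smul hB₀' C
  have hmem : B₀ + t • C ∈ so l K := by
    rw [mem_so] at hB₀ hC ⊢
    rw [Matrix.transpose_add, Matrix.transpose_smul, hB₀, hC, neg_add, smul_neg]
  have e : C = t⁻¹ • ((B₀ + t • C) - B₀) := by rw [add_sub_cancel_left, smul_smul, inv_mul_cancel₀ ht, one_smul]
  rw [e]
  exact Submodule.smul_mem _ _ (Submodule.sub_mem _ (Submodule.subset_span ⟨hmem, hunit⟩)
    (Submodule.subset_span ⟨hB₀, hB₀'⟩))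

/-- **`𝔰𝔬_l(K)` IS SPANNED BY ITS INVERTIBLE ELEMENTS when `|l|` is even** (`K` an infinite field) — the non-degenerate
`2`-vectors span `⋀²` (membership form; the span is trivially contained in `𝔰𝔬_l(K)`). [cite: LooijengaLunts1997, §3 proof of (3.3) ("The corresponding 2-vectors form an open subset of ⋀²V")] -/
theorem mem_span_so_isUnit_det_of_equiv [Infinite K] (e : l ≃ Fin 2 × m) {C : Matrix l l K} (hC : C ∈ so l K) :
    C ∈ Submodule.span K {B : Matrix l l K | B ∈ so l K ∧ IsUnit B.det} := by
  obtain ⟨B₀, hB₀, hB₀'⟩ := exists_mem_so_isUnit_det (K := K) e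
  exact mem_span_so_isUnit_det hB₀ hB₀' hC

end InvertibleSkew

end Literature.LinearAlgebra.Matrix

namespace Literature.Geometry.Kaehler

namespace ComplexTorus

open Literature.LinearAlgebra.Alternating
open Literature.LinearAlgebra.Alternating.GForm (intC)
open Literature.LinearAlgebra.Matrix (lowD lowD_add lowD_smul mem_span_so_isUnit_det_of_equiv)
open LieAlgebra.Orthogonal (so mem_so)

/-! ### §1 Every skew rational matrix is the Gram matrix of a rational real `2`-form; non-degenerate iff invertible -/

section GramRealisation

variable {ι : Type*} [Fintype ι] [DecidableEq ι] {E : Type*} [NormedAddCommGroup E] [NormedSpace ℂ E]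
  (Φ : (ι → ℝ) ≃L[ℝ] E)

/-- A `2`-form is determined by its values on the literal pairs `![u, v]`. [folklore] -/
private theorem twoForm_apply_eq_vecCons'' {F : Type*} [NormedAddCommGroup F] [NormedSpace ℝ F]
    (γ : E [⋀^Fin 2]→L[ℝ] F) (v : Fin 2 → E) : γ v = γ ![v 0, v 1] := by
  congr 1; funext i; fin_cases i <;> rfl

omit [Fintype ι] in
/-- `(dx_a ∧ dx_b)(λ_c, λ_d) = δ_{ac}δ_{bd} - δ_{ad}δ_{bc}` on the lattice basis. [cite: Lange2023AbelianVarietiesComplex, §1.1.4 Prop. 1.1.20] -/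
theorem pairForm_latticeDx_apply_single (a b c d : ι) :
    pairForm (latticeDx Φ a) (latticeDx Φ b) ![Φ (Pi.single c 1), Φ (Pi.single d 1)] =
      (if a = c then 1 else 0) * (if b = d then 1 else 0) - (if a = d then 1 else 0) * (if b = c then 1 else 0) := by
  rw [pairForm_apply, latticeDx_apply_apply, latticeDx_apply_apply, latticeDx_apply_apply, latticeDx_apply_apply]
  simp only [Pi.single_apply]

/-- A double Kronecker sum collapses: `∑_{a,b} f(a,b) δ_{ac} δ_{bd} = f(c,d)`. [folklore] -/
private theorem sum_sum_mul_ite_ite (f : ι → ι → ℝ) (c d : ι) :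
    ∑ a, ∑ b, f a b * ((if a = c then (1 : ℝ) else 0) * (if b = d then 1 else 0)) = f c d := by
  rw [Finset.sum_eq_single c (fun a _ hac ↦ by simp [hac]) (by simp),
    Finset.sum_eq_single d (fun b _ hbd ↦ by simp [hbd]) (by simp)]
  simp

/-- **Every skew-symmetric rational matrix is the Gram matrix, on the lattice basis, of a real `2`-form**:
`η_G = ½ ∑_{a,b} G_{ab} dx_a ∧ dx_b` has `η_G(λ_c, λ_d) = G_{cd}`. [cite: Lange2023AbelianVarietiesComplex, §1.5.1] [cite: LooijengaLunts1997, §3 proof of (3.3) ("κ = ∑ α_{-k} ∧ α_k")] -/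
theorem exists_map_ratCast_eq_latticeGram_of_transpose_eq_neg {G₀ : Matrix ι ι ℚ} (hG₀ : G₀ᵀ = -G₀) :
    ∃ η : E [⋀^Fin 2]→L[ℝ] ℝ, G₀.map ((↑) : ℚ → ℝ) = latticeGram Φ η := by
  refine ⟨∑ a, ∑ b, ((G₀ a b / 2 : ℚ) : ℝ) • pairForm (latticeDx Φ a) (latticeDx Φ b), ?_⟩
  ext c d
  have hdc : G₀ d c = -G₀ c d := by
    have h := congrFun (congrFun hG₀ c) d
    rwa [Matrix.transpose_apply, Matrix.neg_apply] at h
  rw [Matrix.map_apply, latticeGram_apply]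
  simp only [ContinuousAlternatingMap.sum_apply, ContinuousAlternatingMap.smul_apply, pairForm_latticeDx_apply_single,
    smul_eq_mul, mul_sub, Finset.sum_sub_distrib, sum_sum_mul_ite_ite, hdc]
  push_cast
  ring

/-- **A real `2`-form with a RATIONAL Gram matrix on the lattice basis is a rational class** (`η ∈ H²(X; ℚ)`).
[cite: Lange2023AbelianVarietiesComplex, §1.1.3 Cor. 1.1.19, §1.5.1] -/
theorem ofRealForm_mem_rationalForms_of_map_ratCast_eq_latticeGram {η : E [⋀^Fin 2]→L[ℝ] ℝ} {G₀ : Matrix ι ι ℚ}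
    (hG₀ : G₀.map ((↑) : ℚ → ℝ) = latticeGram Φ η) : ofRealForm η ∈ rationalForms Φ 2 := fun m ↦ by
  refine ⟨(fun i ↦ (m 0 i : ℚ)) ⬝ᵥ G₀ *ᵥ (fun i ↦ (m 1 i : ℚ)), ?_⟩
  rw [twoForm_apply_eq_vecCons'', ofRealForm_apply, latticeTuple_apply, latticeTuple_apply,
    show latticeVec Φ (m 0) = Φ (fun i ↦ ((m 0 i : ℤ) : ℝ)) from rfl,
    show latticeVec Φ (m 1) = Φ (fun i ↦ ((m 1 i : ℤ) : ℝ)) from rfl, ← dotProduct_latticeGram_mulVec Φ, ← hG₀,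
    ← Complex.ofReal_ratCast]
  congr 1
  simp only [dotProduct, Matrix.mulVec, Matrix.map_apply]
  push_cast
  rfl

omit [DecidableEq ι] in
include Φ in
/-- The lattice index type of a complex torus of dimension `g` has `2g` elements: `ι ≃ Fin 2 × Fin g` (`Λ ≅ ℤ^{2g}`).
[cite: Lange2023AbelianVarietiesComplex, §1.1.2] -/
theorem nonempty_equiv_fin_two_prod [FiniteDimensional ℂ E] : Nonempty (ι ≃ Fin 2 × Fin (finrank ℂ E)) :=
  ⟨(Fintype.equivFinOfCardEq (card_eq_two_mul_finrank Φ)).trans finProdFinEquiv.symm⟩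

/-- **Every INVERTIBLE skew rational matrix is the Gram matrix of a RATIONAL NON-DEGENERATE real `2`-form** (the domain of
`f : H²(X; ℚ) ⇢ 𝔤_tot(X; ℚ)₋₂` maps onto the invertible `2`-vectors). [cite: LooijengaLunts1997, §3 proof of (3.3)] [cite: Lange2023AbelianVarietiesComplex, §1.5.1] -/
theorem exists_rational_nondegenerate_latticeGram_eq {G₀ : Matrix ι ι ℚ} (hG₀ : G₀ᵀ = -G₀) (hdet : IsUnit G₀.det) :
    ∃ η : E [⋀^Fin 2]→L[ℝ] ℝ, ofRealForm η ∈ rationalForms Φ 2 ∧ (∀ v : E, v ≠ 0 → ∃ w : E, η ![v, w] ≠ 0) ∧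
      G₀.map ((↑) : ℚ → ℝ) = latticeGram Φ η := by
  obtain ⟨η, hη⟩ := exists_map_ratCast_eq_latticeGram_of_transpose_eq_neg Φ hG₀
  exact ⟨η, ofRealForm_mem_rationalForms_of_map_ratCast_eq_latticeGram Φ hη, nondegenerate_of_map_ratCast Φ hη hdet, hη⟩

end GramRealisation

/-! ### §2 `f_η = ρψ₋₂(-G₀⁻¹)`: the image of `f` on rational points is `ρψ₋₂` of the invertible skew rational matrices -/

section ImageOfF

variable {ι : Type*} [Fintype ι] [DecidableEq ι] {E : Type*} [NormedAddCommGroup E] [NormedSpace ℂ E]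
  [FiniteDimensional ℂ E] [Nontrivial E] (Φ : (ι → ℝ) ≃L[ℝ] E)

/-- **`f_η = ρ(T_{ψ₋₂(-G₀⁻¹)})`**: the dual Lefschetz operator of a rational non-degenerate `2`-form is row A1-72's rational
spinor image of the `ψ₋₂`-block of MINUS THE INVERSE GRAM MATRIX (`f_κ = ρψ₋₂(κ⁻¹)`; the sign is the orientation
convention `ψ₋₂(a ∧ b) ↦ i_a i_b` of row A1-74's `spinorRepLin_ratEndo_lowD`). [cite: LooijengaLunts1997, §3 (3.1)–(3.3) and proof of (3.3)] -/
theorem lefschetzDualG_eq_spinorRepLin_ratEndo_lowD {η : E [⋀^Fin 2]→L[ℝ] ℝ}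
    (hnd : ∀ v : E, v ≠ 0 → ∃ w : E, η ![v, w] ≠ 0) {G₀ : Matrix ι ι ℚ} (hG₀ : G₀.map ((↑) : ℚ → ℝ) = latticeGram Φ η) :
    lefschetzDualG η = spinorRepLin E (ratEndo Φ (lowD (-G₀⁻¹))) := by
  rw [lefschetzDualG_eq_sum Φ hnd hG₀, spinorRepLin_ratEndo_lowD, Finset.sum_comm]
  simp only [Matrix.neg_apply, Rat.cast_neg, neg_smul, Finset.sum_neg_distrib, smul_neg, neg_neg, one_div]

/-- `(-B)⁻¹ = -B⁻¹` for an invertible matrix. [folklore] -/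
private theorem neg_inv_eq' {B : Matrix ι ι ℚ} (hB : IsUnit B.det) : (-B)⁻¹ = -B⁻¹ :=
  Matrix.inv_eq_right_inv (by rw [neg_mul_neg, Matrix.mul_nonsing_inv B hB])

/-- `det(-B)` is a unit when `det B` is. [folklore] -/
private theorem isUnit_det_neg' {B : Matrix ι ι ℚ} (hB : IsUnit B.det) : IsUnit (-B).det := by
  rw [Matrix.det_neg]
  exact ((isUnit_one.neg).pow _).mul hB

/-- `-B⁻¹` is skew when `B` is skew and invertible. [folklore] -/
private theorem transpose_neg_inv_of_skew {B : Matrix ι ι ℚ} (hB : Bᵀ = -B) (hBdet : IsUnit B.det) :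
    (-B⁻¹)ᵀ = -(-B⁻¹) := by
  rw [Matrix.transpose_neg, Matrix.transpose_nonsing_inv, hB, neg_inv_eq' hBdet]

/-- **EVERY `ρψ₋₂(B)`, `B` AN INVERTIBLE SKEW RATIONAL MATRIX, IS AN `f_η`** for a rational non-degenerate real `2`-form `η`
(namely the one with Gram matrix `G₀ = -B⁻¹`: then `-G₀⁻¹ = B`). [cite: LooijengaLunts1997, §3 proof of (3.3) ("The corresponding 2-vectors form an open subset of ⋀²V")] -/
theorem exists_lefschetzDualG_eq_of_isUnit_det {B : Matrix ι ι ℚ} (hB : Bᵀ = -B) (hBdet : IsUnit B.det) :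
    ∃ η : E [⋀^Fin 2]→L[ℝ] ℝ, ofRealForm η ∈ rationalForms Φ 2 ∧ (∀ v : E, v ≠ 0 → ∃ w : E, η ![v, w] ≠ 0) ∧
      lefschetzDualG η = spinorRepLin E (ratEndo Φ (lowD B)) := by
  obtain ⟨η, hη, hnd, hG⟩ := exists_rational_nondegenerate_latticeGram_eq Φ (transpose_neg_inv_of_skew hB hBdet)
    (by rw [← neg_inv_eq' hBdet]; exact Matrix.isUnit_nonsing_inv_det _ (isUnit_det_neg' hBdet))
  refine ⟨η, hη, hnd, ?_⟩
  rw [lefschetzDualG_eq_spinorRepLin_ratEndo_lowD Φ hnd hG, ← neg_inv_eq' hBdet,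
    Matrix.nonsing_inv_nonsing_inv _ (isUnit_det_neg' hBdet), neg_neg]

end ImageOfF

/-! ### §3 `𝔤_tot(X; ℚ)₋₂ = span_ℚ {f_η : η ∈ H²(X; ℚ) non-degenerate}` (`g ≥ 2`) -/

section Span

variable {ι : Type*} [Fintype ι] [DecidableEq ι] {E : Type*} [NormedAddCommGroup E] [NormedSpace ℂ E]
  [FiniteDimensional ℂ E] [Nontrivial E] (Φ : (ι → ℝ) ≃L[ℝ] E)

/-- `ρ(T_{ψ₋₂(C)}) ∈ span_ℚ {f_η}` for every skew rational `C`: `C` is a `ℚ`-combination of invertible skew matrices (§0) and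
`C ↦ ρ(T_{ψ₋₂(C)})` is `ℚ`-linear. [cite: LooijengaLunts1997, §3 proof of (3.3)] -/
theorem spinorRepLin_ratEndo_lowD_mem_span_lefschetzDualG {C : Matrix ι ι ℚ} (hC : Cᵀ = -C) :
    spinorRepLin E (ratEndo Φ (lowD C)) ∈ Submodule.span ℚ {T : Module.End ℂ (GForm E ℂ) |
      ∃ η : E [⋀^Fin 2]→L[ℝ] ℝ, ofRealForm η ∈ rationalForms Φ 2 ∧ (∀ v : E, v ≠ 0 → ∃ w : E, η ![v, w] ≠ 0) ∧
        T = lefschetzDualG η} := by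
  obtain ⟨e⟩ := nonempty_equiv_fin_two_prod Φ
  have hC' : C ∈ so ι ℚ := (mem_so _ _ _).2 hC
  refine Submodule.span_induction (p := fun C _ ↦ spinorRepLin E (ratEndo Φ (lowD C)) ∈ Submodule.span ℚ
      {T : Module.End ℂ (GForm E ℂ) | ∃ η : E [⋀^Fin 2]→L[ℝ] ℝ, ofRealForm η ∈ rationalForms Φ 2 ∧
        (∀ v : E, v ≠ 0 → ∃ w : E, η ![v, w] ≠ 0) ∧ T = lefschetzDualG η}) ?_ ?_ ?_ ?_
    (mem_span_so_isUnit_det_of_equiv e hC')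
  · rintro B ⟨hB, hBdet⟩
    obtain ⟨η, hη, hnd, hfη⟩ := exists_lefschetzDualG_eq_of_isUnit_det Φ ((mem_so _ _ _).1 hB) hBdet
    exact Submodule.subset_span ⟨η, hη, hnd, hfη.symm⟩
  · have h0 : lowD (0 : Matrix ι ι ℚ) = 0 := by rw [← zero_smul ℚ (0 : Matrix ι ι ℚ), lowD_smul, zero_smul]
    rw [h0, map_zero, map_zero]
    exact Submodule.zero_mem _
  · intro B B' _ _ hB hB'
    rw [lowD_add, map_add, map_add]
    exact Submodule.add_mem _ hB hB'
  · intro q B _ hB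
    rw [lowD_smul, ratEndo_smul, map_smul, Rat.cast_smul_eq_qsmul]
    exact Submodule.smul_mem _ _ hB

/-- **`𝔤_tot(X; ℚ)₋₂ = span_ℚ {f_η : η ∈ H²(X; ℚ) real, non-degenerate}`** (`g ≥ 2`): the image of the partial map
`f : 𝔞 = H²(X; ℚ) ⇢ 𝔤₋₂` SPANS the degree-`-2` piece on the rational points ("the corresponding `2`-vectors form an open subset of
`⋀²V` and so `𝔤_tot(X)` is generated by `𝔤₂ ⊕ 𝔤₋₂`" — over `ℚ`: the invertible skew rational matrices span `𝔰𝔬_{2g}(ℚ) ≅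
⋀²V_ℚ`). With rows A1-79 (`𝔤_tot(X; ℚ)` is generated by `𝔤₂(ℚ) ∪ 𝔤₋₂(ℚ)`) and A1-80 (`𝔤₂(ℚ) = e(H²(X; ℚ))`): clause (ii) of
the Lefschetz triple `(𝔤_tot(X; ℚ), h, H²(X; ℚ))` — `𝔤_tot(X; ℚ)` is generated by `e(𝔞)` and the image of `f`.
[cite: LooijengaLunts1997, §1 (1.1) (ii), §3 (3.3) and its proof] -/
theorem totalLieAlgebraRatDeg_negTwo_eq_span_lefschetzDualG (h2 : 2 ≤ finrank ℂ E) :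
    totalLieAlgebraRatDeg Φ (-2) = Submodule.span ℚ {T : Module.End ℂ (GForm E ℂ) |
      ∃ η : E [⋀^Fin 2]→L[ℝ] ℝ, ofRealForm η ∈ rationalForms Φ 2 ∧ (∀ v : E, v ≠ 0 → ∃ w : E, η ![v, w] ≠ 0) ∧
        T = lefschetzDualG η} := by
  refine le_antisymm (fun T hT ↦ ?_) (Submodule.span_le.2 ?_)
  · obtain ⟨C, hC, rfl⟩ := (mem_totalLieAlgebraRatDeg_negTwo_iff Φ h2).1 hT
    exact spinorRepLin_ratEndo_lowD_mem_span_lefschetzDualG Φ hC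
  · rintro _ ⟨η, hη, hnd, rfl⟩
    exact lefschetzDualG_mem_totalLieAlgebraRatDeg_negTwo Φ hη hnd

omit [Nontrivial E] in
/-- **The domain of `f` is non-empty over `ℚ`: every complex torus carries a RATIONAL NON-DEGENERATE real `2`-form** (no
complex-structure condition — not necessarily a polarisation). [cite: LooijengaLunts1997, §3 proof of (3.3) ("The nondegenerate 2-forms make up a nonempty open subset")] -/
theorem exists_rational_nondegenerate_twoForm :
    ∃ η : E [⋀^Fin 2]→L[ℝ] ℝ, ofRealForm η ∈ rationalForms Φ 2 ∧ ∀ v : E, v ≠ 0 → ∃ w : E, η ![v, w] ≠ 0 := by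
  obtain ⟨e⟩ := nonempty_equiv_fin_two_prod Φ
  obtain ⟨J, hJ, hJdet⟩ := Literature.LinearAlgebra.Matrix.exists_mem_so_isUnit_det (K := ℚ) e
  obtain ⟨η, hη, hnd, -⟩ := exists_rational_nondegenerate_latticeGram_eq Φ ((mem_so _ _ _).1 hJ) hJdet
  exact ⟨η, hη, hnd⟩

/-- **VALIDATION (Layer-A referee; abelian SURFACE): `dim_ℚ span_ℚ {f_η : η rational non-degenerate} = 6 = C(4, 2)`** — the
`f_η` span all of `𝔤_tot(X; ℚ)₋₂ ≅ ⋀²V_ℚ` (row A1-75's `finrank_totalLieAlgebraRatDeg_finTwo`). [cite: LooijengaLunts1997, §3 (3.3)] -/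
theorem finrank_span_lefschetzDualG_finTwo (Φ : (ι → ℝ) ≃L[ℝ] (Fin 2 → ℂ)) :
    finrank ℚ (Submodule.span ℚ {T : Module.End ℂ (GForm (Fin 2 → ℂ) ℂ) |
      ∃ η : (Fin 2 → ℂ) [⋀^Fin 2]→L[ℝ] ℝ, ofRealForm η ∈ rationalForms Φ 2 ∧
        (∀ v : Fin 2 → ℂ, v ≠ 0 → ∃ w : Fin 2 → ℂ, η ![v, w] ≠ 0) ∧ T = lefschetzDualG η}) = 6 := by
  have h2 : 2 ≤ finrank ℂ (Fin 2 → ℂ) := by rw [Module.finrank_fin_fun]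
  rw [← totalLieAlgebraRatDeg_negTwo_eq_span_lefschetzDualG Φ h2]
  exact (finrank_totalLieAlgebraRatDeg_finTwo Φ).2.2

end Span

end ComplexTorus

end Literature.Geometry.Kaehler
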